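import Mathlib
import Summits.ValiantsHypothesis.ValiantsHypothesis.Theorems.RigidityForcesSymmetryRankRigidMinimalReprLaplaceTriangular

/-!
# The support-core engine, part 1: the 2 × 2 core, support three, and the block permanent
# (crux `RankRigidMinimalRepr`, stmt-ValiantsHypothesis-18034; frontier rung `LaplaceOptimalFive`, stmt-24813)

Algebraic ingredients of the SUPPORT-CORE variant of the dual-witness construction for `LaplaceOptimal 5` (the
engines `triangular_witness` / `hybrid_witness` / `hybrid_witness2` build covector tuples with a TRIANGULAR permanent;
this variant allows ONE `2 × 2` block):

* `offdiag_ne_zero_of_support_three` — if `φ` has at least three non-zero coordinates in a set `F` of columns and `ψ`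
  does not vanish on `F`, then `φ(a) ψ(b) + φ(b) ψ(a) ≠ 0` for some `a ≠ b` in `F` (the `2 × 2` permanent pattern of the
  two rows on the columns `a, b`).  Sharp: it fails exactly when `φ` is supported on `≤ 2` columns.
* `exists_orthogonal_support_three` — fewer than `n - 2` homogeneous linear conditions in `ℂⁿ` have a common solution
  with at least three non-zero coordinates.
* `permanent_eq_of_block` — the permanent of a block-triangular matrix with singleton diagonal blocks and one `2 × 2`
  block `{A, B}` is the product of the singleton pivots times the `2 × 2` permanent of the block.

General `n`; no definitions.  HONEST FRAMING: infrastructure for the frontier rung `LaplaceOptimalFive` (stmt-24813),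
which stays OPEN; nothing here bears on `VP ≠ VNP`.
-/

set_option autoImplicit false

-- the mandated summit-side namespace repeats a component by design (single-problem summit)
set_option linter.dupNamespace false

namespace Summit.ValiantsHypothesis.ValiantsHypothesis.Theorems.RigidityForcesSymmetryRankRigidMinimalRepr

namespace LaplaceTriangular

open Finset

variable {n : ℕ}

/-! ### §1 The `2 × 2` core -/

/-- **The `2 × 2` core.**  If `φ` has at least three non-zero coordinates in `F` and `ψ` does not vanish on `F`, then
`φ a * ψ b + φ b * ψ a ≠ 0` for some `a ≠ b` in `F`. -/
theorem offdiag_ne_zero_of_support_three (F : Finset (Fin n)) (φ ψ : Fin n → ℂ)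
    (hφ : 3 ≤ (F.filter (fun c => φ c ≠ 0)).card) (hψ : ∃ c ∈ F, ψ c ≠ 0) :
    ∃ a ∈ F, ∃ b ∈ F, a ≠ b ∧ φ a * ψ b + φ b * ψ a ≠ 0 := by
  classical
  by_contra hall
  push Not at hall
  set Sp := F.filter (fun c => φ c ≠ 0) with hSp
  obtain ⟨c, hcF, hc⟩ := hψ
  -- `ψ` vanishes on `F` off the support of `φ`, so `φ c ≠ 0`
  have hφc : φ c ≠ 0 := by
    by_contra h0
    -- pick `a` in the support of `φ`
    obtain ⟨a, ha⟩ : ∃ a, a ∈ Sp := card_pos.mp (by omega)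
    rw [hSp, mem_filter] at ha
    have hac : a ≠ c := fun e => ha.2 (e ▸ h0)
    have := hall a ha.1 c hcF hac
    rw [h0, zero_mul, add_zero] at this
    exact mul_ne_zero ha.2 hc this
  -- two further support elements `a ≠ b`, both `≠ c`
  have hcard2 : 2 ≤ (Sp.erase c).card := by
    have := card_erase_of_mem (s := Sp) (a := c) (by rw [hSp, mem_filter]; exact ⟨hcF, hφc⟩)
    omega
  obtain ⟨a, ha, b, hb, hab⟩ := one_lt_card.mp hcard2
  rw [mem_erase, hSp, mem_filter] at ha hb
  have hac := hall a ha.2.1 c hcF ha.1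
  have hbc := hall b hb.2.1 c hcF hb.1
  have habE := hall a ha.2.1 b hb.2.1 hab
  have key : φ c * (φ a * ψ b + φ b * ψ a) = -2 * (φ a * φ b * ψ c) := by
    linear_combination φ a * hbc + φ b * hac
  rw [habE, mul_zero] at key
  have : φ a * φ b * ψ c ≠ 0 := mul_ne_zero (mul_ne_zero ha.2.2 hb.2.2) hc
  apply this
  have h2 : (-2 : ℂ) ≠ 0 := by norm_num
  exact (mul_eq_zero.mp key.symm).resolve_left h2

/-! ### §2 A common solution with three non-zero coordinates -/

/-- Fewer than `n - 2` homogeneous linear conditions in `ℂⁿ` have a common solution with at least THREE non-zero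
coordinates. -/
theorem exists_orthogonal_support_three (T : Finset (Fin n → ℂ)) (hT : T.card + 3 ≤ n) :
    ∃ φ : Fin n → ℂ, (∀ a ∈ T, ∑ c, φ c * a c = 0) ∧ 3 ≤ (univ.filter (fun c => φ c ≠ 0)).card := by
  classical
  -- three triangular solutions
  obtain ⟨ψ₁, h₁0, h₁⟩ := exists_ne_zero_orthogonal T (by omega)
  obtain ⟨a₁, ha₁⟩ : ∃ x, ψ₁ x ≠ 0 := by by_contra h; push Not at h; exact h₁0 (funext h)
  obtain ⟨ψ₂, h₂0, h₂⟩ := exists_ne_zero_orthogonal (insert (Pi.single a₁ 1) T)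
    (lt_of_le_of_lt (card_insert_le _ _) (by omega))
  obtain ⟨a₂, ha₂⟩ : ∃ x, ψ₂ x ≠ 0 := by by_contra h; push Not at h; exact h₂0 (funext h)
  have h₂T : ∀ a ∈ T, ∑ c, ψ₂ c * a c = 0 := fun a ha => h₂ a (mem_insert_of_mem ha)
  have h₂a₁ : ψ₂ a₁ = 0 := by simpa [Pi.single_apply] using h₂ _ (mem_insert_self _ _)
  obtain ⟨ψ₃, h₃0, h₃⟩ := exists_ne_zero_orthogonal (insert (Pi.single a₂ 1) (insert (Pi.single a₁ 1) T))
    (lt_of_le_of_lt ((card_insert_le _ _).trans (Nat.succ_le_succ (card_insert_le _ _))) (by omega))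
  obtain ⟨a₃, ha₃⟩ : ∃ x, ψ₃ x ≠ 0 := by by_contra h; push Not at h; exact h₃0 (funext h)
  have h₃T : ∀ a ∈ T, ∑ c, ψ₃ c * a c = 0 := fun a ha => h₃ a (mem_insert_of_mem (mem_insert_of_mem ha))
  have h₃a₁ : ψ₃ a₁ = 0 := by
    simpa [Pi.single_apply] using h₃ _ (mem_insert_of_mem (mem_insert_self _ _))
  have h₃a₂ : ψ₃ a₂ = 0 := by simpa [Pi.single_apply] using h₃ _ (mem_insert_self _ _)
  have h12 : a₁ ≠ a₂ := fun e => ha₂ (e ▸ h₂a₁)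
  have h13 : a₁ ≠ a₃ := fun e => ha₃ (e ▸ h₃a₁)
  have h23 : a₂ ≠ a₃ := fun e => ha₃ (e ▸ h₃a₂)
  -- the combination `y ψ₁ + x ψ₂ + ψ₃`
  have hsol : ∀ x y : ℂ, ∀ a ∈ T, ∑ c, (y * ψ₁ c + x * ψ₂ c + ψ₃ c) * a c = 0 := by
    intro x y a ha
    have e1 := h₁ a ha; have e2 := h₂T a ha; have e3 := h₃T a ha
    calc ∑ c, (y * ψ₁ c + x * ψ₂ c + ψ₃ c) * a c
        = y * ∑ c, ψ₁ c * a c + x * ∑ c, ψ₂ c * a c + ∑ c, ψ₃ c * a c := by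
          simp only [mul_sum, ← sum_add_distrib]; refine sum_congr rfl fun c _ => by ring
      _ = 0 := by rw [e1, e2, e3]; ring
  -- choose `y ∈ {1, 2}` with `y ψ₁ a₃ + ψ₃ a₃ ≠ 0`
  obtain ⟨y, hy0, hy3⟩ : ∃ y : ℂ, y ≠ 0 ∧ y * ψ₁ a₃ + ψ₃ a₃ ≠ 0 := by
    by_cases h : 1 * ψ₁ a₃ + ψ₃ a₃ = 0
    · refine ⟨2, two_ne_zero, fun h' => ha₃ ?_⟩
      linear_combination 2 * h - h'
    · exact ⟨1, one_ne_zero, h⟩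
  -- choose `x ∈ {0, 1, 2}` avoiding the two bad values
  obtain ⟨x, hx2, hx3⟩ : ∃ x : ℂ, y * ψ₁ a₂ + x * ψ₂ a₂ ≠ 0 ∧ y * ψ₁ a₃ + x * ψ₂ a₃ + ψ₃ a₃ ≠ 0 := by
    by_contra hnone
    push Not at hnone
    -- each condition fails for at most one of `0, 1, 2`
    have bad2 : ∀ x x' : ℂ, x ≠ x' → y * ψ₁ a₂ + x * ψ₂ a₂ = 0 → y * ψ₁ a₂ + x' * ψ₂ a₂ = 0 → False := by
      intro x x' hxx e e'
      apply hxx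
      have : (x - x') * ψ₂ a₂ = 0 := by linear_combination e - e'
      exact sub_eq_zero.mp ((mul_eq_zero.mp this).resolve_right ha₂)
    have bad3 : ∀ x x' : ℂ, x ≠ x' → y * ψ₁ a₃ + x * ψ₂ a₃ + ψ₃ a₃ = 0 →
        y * ψ₁ a₃ + x' * ψ₂ a₃ + ψ₃ a₃ = 0 → False := by
      intro x x' hxx e e'
      have : (x - x') * ψ₂ a₃ = 0 := by linear_combination e - e'
      rcases mul_eq_zero.mp this with h | h
      · exact hxx (sub_eq_zero.mp h)
      · apply hy3; rw [h, mul_zero, add_zero] at e; exact e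
    have c0 := hnone 0; have c1 := hnone 1; have c2 := hnone 2
    by_cases e0 : y * ψ₁ a₂ + 0 * ψ₂ a₂ = 0
    · by_cases e1 : y * ψ₁ a₂ + 1 * ψ₂ a₂ = 0
      · exact bad2 0 1 (by norm_num) e0 e1
      · by_cases e2 : y * ψ₁ a₂ + 2 * ψ₂ a₂ = 0
        · exact bad2 0 2 (by norm_num) e0 e2
        · exact bad3 1 2 (by norm_num) (c1 e1) (c2 e2)
    · by_cases e1 : y * ψ₁ a₂ + 1 * ψ₂ a₂ = 0
      · by_cases e2 : y * ψ₁ a₂ + 2 * ψ₂ a₂ = 0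
        · exact bad2 1 2 (by norm_num) e1 e2
        · exact bad3 0 2 (by norm_num) (c0 e0) (c2 e2)
      · exact bad3 0 1 (by norm_num) (c0 e0) (c1 e1)
  refine ⟨fun c => y * ψ₁ c + x * ψ₂ c + ψ₃ c, hsol x y, ?_⟩
  have hsub : ({a₁, a₂, a₃} : Finset (Fin n)) ⊆ univ.filter (fun c => y * ψ₁ c + x * ψ₂ c + ψ₃ c ≠ 0) := by
    intro c hc
    simp only [mem_insert, mem_singleton] at hc
    rw [mem_filter]
    refine ⟨mem_univ _, ?_⟩
    rcases hc with rfl | rfl | rfl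
    · rw [h₂a₁, h₃a₁]; simpa using mul_ne_zero hy0 ha₁
    · rw [h₃a₂, add_zero]; exact hx2
    · exact hx3
  refine le_trans ?_ (card_le_card hsub)
  rw [card_insert_of_notMem (by simp [h12, h13]), card_insert_of_notMem (by simp [h23]), card_singleton]

/-! ### §3 The block permanent -/

/-- **Block-triangular permanent with one `2 × 2` block.**  Slots carry levels `L`, injective except that the two
distinct slots `A, B` share a level; pivots `τ`; if `φ_i(τ i') = 0` whenever `L i' < L i`, then
`per (φ_i(c))_{c,i} = (Π_{i ≠ A, B} φ_i(τ i)) · (φ_A(τ A) φ_B(τ B) + φ_A(τ B) φ_B(τ A))`. -/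
theorem permanent_eq_of_block (φ : Fin n → Fin n → ℂ) (τ : Equiv.Perm (Fin n)) (L : Fin n → ℕ) (A B : Fin n)
    (hAB : A ≠ B) (hLAB : L A = L B) (hL : ∀ i i', L i = L i' → i = i' ∨ (i = A ∧ i' = B) ∨ (i = B ∧ i' = A))
    (htri : ∀ i i', L i' < L i → φ i (τ i') = 0) :
    (Matrix.of fun c i => φ i c).permanent =
      (∏ i ∈ (univ.erase A).erase B, φ i (τ i)) * (φ A (τ A) * φ B (τ B) + φ A (τ B) * φ B (τ A)) := by
  classical
  unfold Matrix.permanent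
  set τ' : Equiv.Perm (Fin n) := (Equiv.swap A B).trans τ with hτ'
  have hτ'A : τ' A = τ B := by simp [hτ', Equiv.swap_apply_left]
  have hτ'B : τ' B = τ A := by simp [hτ', Equiv.swap_apply_right]
  have hτ'o : ∀ i, i ≠ A → i ≠ B → τ' i = τ i := fun i hA hB => by
    simp [hτ', Equiv.swap_apply_of_ne_of_ne hA hB]
  have hne : τ ≠ τ' := by
    intro h
    have := congrArg (fun σ : Equiv.Perm (Fin n) => σ A) h
    simp only [hτ'A] at this
    exact hAB (τ.injective this)
  rw [Finset.sum_eq_add τ τ' hne]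
  · -- the two surviving permutations
    have hBm : B ∈ univ.erase A := mem_erase.mpr ⟨hAB.symm, mem_univ B⟩
    have e1 : ∏ i, φ i (τ i) = (∏ i ∈ (univ.erase A).erase B, φ i (τ i)) * (φ A (τ A) * φ B (τ B)) := by
      rw [← prod_erase_mul _ _ (mem_univ A), ← prod_erase_mul _ _ hBm]; ring
    have hprod' : ∏ i ∈ (univ.erase A).erase B, φ i (τ' i) = ∏ i ∈ (univ.erase A).erase B, φ i (τ i) :=
      prod_congr rfl (fun i hi => by
        rw [mem_erase, mem_erase] at hi
        rw [hτ'o i hi.2.1 hi.1])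
    have e2 : ∏ i, φ i (τ' i) = (∏ i ∈ (univ.erase A).erase B, φ i (τ i)) * (φ A (τ B) * φ B (τ A)) := by
      rw [← prod_erase_mul _ _ (mem_univ A), ← prod_erase_mul _ _ hBm, hτ'A, hτ'B, hprod']
      ring
    simp only [Matrix.of_apply]
    rw [e1, e2]; ring
  · -- every other permutation has a zero factor
    intro σ _ hσ
    simp only [Matrix.of_apply]
    set π : Equiv.Perm (Fin n) := σ.trans τ.symm with hπ
    have hτπ : ∀ i, τ (π i) = σ i := fun i => by simp [hπ]
    by_contra hprod
    have hall : ∀ i, φ i (σ i) ≠ 0 := fun i h => hprod (prod_eq_zero (mem_univ i) h)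
    have hge : ∀ i ∈ (univ : Finset (Fin n)), L i ≤ L (π i) := by
      intro i _
      by_contra hlt
      push Not at hlt
      have := htri i (π i) hlt
      rw [hτπ] at this
      exact hall i this
    have hsum : ∑ i, L (π i) = ∑ i, L i := Equiv.sum_comp π L
    have heq := (sum_eq_sum_iff_of_le hge).mp hsum.symm
    -- `π` preserves levels, hence fixes every slot other than `A, B`
    have hfix : ∀ i, i ≠ A → i ≠ B → π i = i := by
      intro i hA hB
      rcases hL i (π i) (heq i (mem_univ i)) with h | ⟨h, -⟩ | ⟨h, -⟩
      · exact h.symm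
      · exact absurd h hA
      · exact absurd h hB
    have hπA : π A = A ∨ π A = B := by
      rcases hL A (π A) (heq A (mem_univ A)) with h | ⟨-, h⟩ | ⟨h, -⟩
      · exact Or.inl h.symm
      · exact Or.inr h
      · exact absurd h hAB
    rcases hπA with hA | hA
    · -- then `π = 1`, `σ = τ`
      apply hσ.1
      ext i
      have hπB : π B = B := by
        rcases hL B (π B) (heq B (mem_univ B)) with h | ⟨h, -⟩ | ⟨-, h⟩
        · exact h.symm
        · exact absurd h hAB.symm
        · -- `π B = A = π A` contradicts injectivity
          exact absurd (π.injective (h.trans hA.symm)) hAB.symm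
      have : π i = i := by
        by_cases hiA : i = A
        · rw [hiA, hA]
        · by_cases hiB : i = B
          · rw [hiB, hπB]
          · exact hfix i hiA hiB
      have h2 := hτπ i
      rw [this] at h2
      exact congrArg Fin.val h2.symm
    · -- then `π = swap A B`, `σ = τ'`
      apply hσ.2
      ext i
      have hπB : π B = A := by
        rcases hL B (π B) (heq B (mem_univ B)) with h | ⟨h, -⟩ | ⟨-, h⟩
        · exact absurd (π.injective (hA.trans h)) hAB
        · exact absurd h hAB.symm
        · exact h
      have h2 := hτπ i
      by_cases hiA : i = A
      · subst hiA; rw [hA] at h2; rw [hτ'A]; exact congrArg Fin.val h2.symm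
      · by_cases hiB : i = B
        · subst hiB; rw [hπB] at h2; rw [hτ'B]; exact congrArg Fin.val h2.symm
        · rw [hfix i hiA hiB] at h2; rw [hτ'o i hiA hiB]; exact congrArg Fin.val h2.symm
  · intro h; exact absurd (mem_univ τ) h
  · intro h; exact absurd (mem_univ τ') h

end LaplaceTriangular

end Summit.ValiantsHypothesis.ValiantsHypothesis.Theorems.RigidityForcesSymmetryRankRigidMinimalRepr
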